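import Summits.Ventures.LatticeQCDFlow.Scoring.SUNWilsonLoopTraceSqMoment2D
import Summits.Ventures.LatticeQCDFlow.Scoring.UNWilsonLoopVariance2D
import HarnessLib

/-!
# The exact variance of two-dimensional `SU(N)` Wilson loops: `Var_β(N⁻¹Re tr W_{R×T})` in closed form

HONEST FRAMING: exact (Metropolis-corrected) sampling algorithms for lattice gauge theory;
figures of merit are autocorrelation/cost numbers at stated couplings and volumes; no
continuum-physics claim.

Venture `LatticeQCDFlow` (cell pub-lqcd), sub-topic `Scoring`; FANOUT row 5 (`s0-sun-a`), GEN-21.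
NEW WORK of the cell (placement rule).  `SU(N)` twin of `UNWilsonLoopVariance2D`: assembly of GEN-21's two quadratic
moments of the free-boundary `R × T` Wilson loop of two-dimensional `SU(N)` lattice Yang–Mills (`N ≥ 2`, every real `β`, weight `e^{−β(N − Re tr U_p)}`,
`R + 1 ≤ L`, `T + 1 ≤ L` in `(ℤ/L)²`) — `⟨|tr W|²⟩ = 1 + (N²−1)·P_adj^{RT}` (`SUNWilsonLoopSecondMoment2D`) and
`⟨(tr W)²⟩ = d_S·P_S^{RT} + d_A·P_A^{RT}` (`SUNWilsonLoopTraceSqMoment2D`) — with `(Re z)² = (|z|² + Re z²)/2`: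

* **`specialUnitary_open_re_trace_sq_wilsonLoop_eq`** — `⟨(Re tr W)²⟩_β = ½·(1 + (N²−1)·P_adj^{RT} + Re(d_S·P_S^{RT} + d_A·P_A^{RT}))`;
* **`specialUnitary_open_wilsonLoop_variance_eq`** — for theory-2's observable `W = N⁻¹Re tr W_{R×T}` (whose mean is
  `P_N(β)^{RT}`, GEN-18): `⟨W²⟩_β − ⟨W⟩_β² = (1 + (N²−1)·P_adj^{RT} + Re(d_S·P_S^{RT} + d_A·P_A^{RT}))/(2N²) − P_N^{2RT}`.

Here all one-plaquette integrals are over `SU(N)`, `D = Σ_{q∈ℤ} det[I_{|q+i−j|}(β)]`, `M₂ = ∫|tr u|²e^{βRe tr u}du`, `s₁ = ∫(tr u)²e^{βRe tr u}du`, `s₂ = ∫tr(u²)e^{βRe tr u}du`,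
`P_adj = (M₂/D − 1)/(N²−1)`, `P_S = (s₁+s₂)/(N(N+1)D)`, `P_A = (s₁−s₂)/(N(N−1)D)`, `d_{S/A} = N(N±1)/2`,
`P_N = ∫N⁻¹Re tr u·e^{−β(N−Re tr u)}du / ∫e^{−β(N−Re tr u)}du`: every one-plaquette quantity is an explicit
`SU(N)` integral (Bars–Green series in GEN-17).  This is THE EXACT SIGNAL-TO-NOISE LAW of `SU(N)` Wilson-loop
measurements in two dimensions (for `SU(2)`, `tr W` is real and `P_A = 1`, so the large-area value is `(1 + 1)/8 = 1/4 =
E_Haar cos²θ`); in general the large-area limit is governed by the moduli of the three normalised plaquettes.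

No `def`, nothing cited as a fact, 0 sorry.
-/

noncomputable section

open MeasureTheory Function Finset
open Literature.MathematicalPhysics.QuantumFieldTheory
open Literature.MathematicalPhysics.QuantumLattice
open Summit.Ventures.LatticeQCDFlow.Theory2.Lattice
open Summit.Ventures.LatticeQCDFlow.Theory2.Lattice.TwoDim
open Literature.Analysis.FunctionSpaces (besselI)

namespace Summit.Ventures.LatticeQCDFlow.Scoring

section SUVariance

variable {L : ℕ} [NeZero L] {N : ℕ}

/-- **`⟨(Re tr W_{R×T})²⟩_β` in closed form** (`SU(N)`, `N ≥ 2`, every real `β`):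
`∫ (Re tr W)² ∏_p e^{−β(N−Re tr U_p)} / ∫ ∏_p e^{−β(N−Re tr U_p)}
  = ½·((1 + (N²−1)·P_adj^{RT}) + Re(d_S·P_S^{RT} + d_A·P_A^{RT}))`. -/
theorem specialUnitary_open_re_trace_sq_wilsonLoop_eq (hN : 2 ≤ N) (β : ℝ) (i j : ZMod L) {R T : ℕ}
    (hR : R + 1 ≤ L) (hT : T + 1 ≤ L) :
    (∫ U, ((rectangleHolonomy U ![i, j] 0 1 R T : Matrix.specialUnitaryGroup (Fin N) ℂ) :
          Matrix (Fin N) (Fin N) ℂ).trace.re ^ 2 *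
        ∏ p ∈ (range R ×ˢ range T).image (fun q : ℕ × ℕ => (![i + q.1, j + q.2] : Site 2 L)),
          Real.exp (-(β * ((N : ℝ) - ((plaquetteHolonomy U p 0 1 : Matrix.specialUnitaryGroup (Fin N) ℂ) :
            Matrix (Fin N) (Fin N) ℂ).trace.re)))
        ∂(Measure.pi fun _ : Edge 2 L => haarProbability (Matrix.specialUnitaryGroup (Fin N) ℂ))) /
      (∫ U, ∏ p ∈ (range R ×ˢ range T).image (fun q : ℕ × ℕ => (![i + q.1, j + q.2] : Site 2 L)),
          Real.exp (-(β * ((N : ℝ) - ((plaquetteHolonomy U p 0 1 : Matrix.specialUnitaryGroup (Fin N) ℂ) :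
            Matrix (Fin N) (Fin N) ℂ).trace.re)))
        ∂(Measure.pi fun _ : Edge 2 L => haarProbability (Matrix.specialUnitaryGroup (Fin N) ℂ))) =
      ((1 + ((N : ℝ) ^ 2 - 1) *
          (((∫ u, (‖((u : Matrix.specialUnitaryGroup (Fin N) ℂ) : Matrix (Fin N) (Fin N) ℂ).trace‖ ^ 2 : ℝ) *
              Real.exp (β * ((u : Matrix.specialUnitaryGroup (Fin N) ℂ) : Matrix (Fin N) (Fin N) ℂ).trace.re)
              ∂(haarProbability (Matrix.specialUnitaryGroup (Fin N) ℂ))) /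
              (∑' q : ℤ, (Matrix.of fun i j : Fin N => besselI (q + (i : ℤ) - (j : ℤ)).natAbs β).det) - 1) / ((N : ℝ) ^ 2 - 1)) ^ (R * T)) +
        (((N : ℂ) * (N + 1) / 2) *
            (((∫ u, ((u : Matrix.specialUnitaryGroup (Fin N) ℂ) : Matrix (Fin N) (Fin N) ℂ).trace ^ 2 *
                (Real.exp (β * ((u : Matrix.specialUnitaryGroup (Fin N) ℂ) : Matrix (Fin N) (Fin N) ℂ).trace.re) : ℂ)
                ∂(haarProbability (Matrix.specialUnitaryGroup (Fin N) ℂ))) +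
              (∫ u, (((u : Matrix.specialUnitaryGroup (Fin N) ℂ) : Matrix (Fin N) (Fin N) ℂ) *
                ((u : Matrix.specialUnitaryGroup (Fin N) ℂ) : Matrix (Fin N) (Fin N) ℂ)).trace *
                (Real.exp (β * ((u : Matrix.specialUnitaryGroup (Fin N) ℂ) : Matrix (Fin N) (Fin N) ℂ).trace.re) : ℂ)
                ∂(haarProbability (Matrix.specialUnitaryGroup (Fin N) ℂ)))) /
              (N * (N + 1) * ((∑' q : ℤ, (Matrix.of fun i j : Fin N => besselI (q + (i : ℤ) - (j : ℤ)).natAbs β).det : ℝ) : ℂ))) ^ (R * T) +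
          ((N : ℂ) * (N - 1) / 2) *
            (((∫ u, ((u : Matrix.specialUnitaryGroup (Fin N) ℂ) : Matrix (Fin N) (Fin N) ℂ).trace ^ 2 *
                (Real.exp (β * ((u : Matrix.specialUnitaryGroup (Fin N) ℂ) : Matrix (Fin N) (Fin N) ℂ).trace.re) : ℂ)
                ∂(haarProbability (Matrix.specialUnitaryGroup (Fin N) ℂ))) -
              (∫ u, (((u : Matrix.specialUnitaryGroup (Fin N) ℂ) : Matrix (Fin N) (Fin N) ℂ) *
                ((u : Matrix.specialUnitaryGroup (Fin N) ℂ) : Matrix (Fin N) (Fin N) ℂ)).trace *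
                (Real.exp (β * ((u : Matrix.specialUnitaryGroup (Fin N) ℂ) : Matrix (Fin N) (Fin N) ℂ).trace.re) : ℂ)
                ∂(haarProbability (Matrix.specialUnitaryGroup (Fin N) ℂ)))) /
              (N * (N - 1) * ((∑' q : ℤ, (Matrix.of fun i j : Fin N => besselI (q + (i : ℤ) - (j : ℤ)).natAbs β).det : ℝ) : ℂ))) ^ (R * T)).re) / 2 := by
  haveI : NeZero N := ⟨by omega⟩
  -- the two GEN-21 moments (stated before the abbreviations so that `set` rewrites them too)
  have h1 := specialUnitary_open_normSq_trace_wilsonLoop_eq (L := L) hN β i j hR hT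
  have h2 := specialUnitary_open_trace_sq_wilsonLoop_eq (L := L) hN β i j hR hT
  have hZ := specialUnitary_open_partitionFunction_eq (L := L) N β i j hR hT
  -- abbreviations
  set μ := (Measure.pi fun _ : Edge 2 L => haarProbability (Matrix.specialUnitaryGroup (Fin N) ℂ)) with hμ
  set Z : ℝ := ∫ U, ∏ p ∈ (range R ×ˢ range T).image (fun q : ℕ × ℕ => (![i + q.1, j + q.2] : Site 2 L)),
      Real.exp (-(β * ((N : ℝ) - ((plaquetteHolonomy U p 0 1 : Matrix.specialUnitaryGroup (Fin N) ℂ) :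
        Matrix (Fin N) (Fin N) ℂ).trace.re))) ∂μ with hZdef
  set A : ℝ := 1 + ((N : ℝ) ^ 2 - 1) *
          (((∫ u, (‖((u : Matrix.specialUnitaryGroup (Fin N) ℂ) : Matrix (Fin N) (Fin N) ℂ).trace‖ ^ 2 : ℝ) *
              Real.exp (β * ((u : Matrix.specialUnitaryGroup (Fin N) ℂ) : Matrix (Fin N) (Fin N) ℂ).trace.re)
              ∂(haarProbability (Matrix.specialUnitaryGroup (Fin N) ℂ))) /
              (∑' q : ℤ, (Matrix.of fun i j : Fin N => besselI (q + (i : ℤ) - (j : ℤ)).natAbs β).det) - 1) / ((N : ℝ) ^ 2 - 1)) ^ (R * T) with hA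
  set B : ℂ := ((N : ℂ) * (N + 1) / 2) *
            (((∫ u, ((u : Matrix.specialUnitaryGroup (Fin N) ℂ) : Matrix (Fin N) (Fin N) ℂ).trace ^ 2 *
                (Real.exp (β * ((u : Matrix.specialUnitaryGroup (Fin N) ℂ) : Matrix (Fin N) (Fin N) ℂ).trace.re) : ℂ)
                ∂(haarProbability (Matrix.specialUnitaryGroup (Fin N) ℂ))) +
              (∫ u, (((u : Matrix.specialUnitaryGroup (Fin N) ℂ) : Matrix (Fin N) (Fin N) ℂ) *
                ((u : Matrix.specialUnitaryGroup (Fin N) ℂ) : Matrix (Fin N) (Fin N) ℂ)).trace *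
                (Real.exp (β * ((u : Matrix.specialUnitaryGroup (Fin N) ℂ) : Matrix (Fin N) (Fin N) ℂ).trace.re) : ℂ)
                ∂(haarProbability (Matrix.specialUnitaryGroup (Fin N) ℂ)))) /
              (N * (N + 1) * ((∑' q : ℤ, (Matrix.of fun i j : Fin N => besselI (q + (i : ℤ) - (j : ℤ)).natAbs β).det : ℝ) : ℂ))) ^ (R * T) +
          ((N : ℂ) * (N - 1) / 2) *
            (((∫ u, ((u : Matrix.specialUnitaryGroup (Fin N) ℂ) : Matrix (Fin N) (Fin N) ℂ).trace ^ 2 *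
                (Real.exp (β * ((u : Matrix.specialUnitaryGroup (Fin N) ℂ) : Matrix (Fin N) (Fin N) ℂ).trace.re) : ℂ)
                ∂(haarProbability (Matrix.specialUnitaryGroup (Fin N) ℂ))) -
              (∫ u, (((u : Matrix.specialUnitaryGroup (Fin N) ℂ) : Matrix (Fin N) (Fin N) ℂ) *
                ((u : Matrix.specialUnitaryGroup (Fin N) ℂ) : Matrix (Fin N) (Fin N) ℂ)).trace *
                (Real.exp (β * ((u : Matrix.specialUnitaryGroup (Fin N) ℂ) : Matrix (Fin N) (Fin N) ℂ).trace.re) : ℂ)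
                ∂(haarProbability (Matrix.specialUnitaryGroup (Fin N) ℂ)))) /
              (N * (N - 1) * ((∑' q : ℤ, (Matrix.of fun i j : Fin N => besselI (q + (i : ℤ) - (j : ℤ)).natAbs β).det : ℝ) : ℂ))) ^ (R * T) with hB
  have hFc : Continuous fun U : GaugeConfig 2 L (Matrix.specialUnitaryGroup (Fin N) ℂ) =>
      ((rectangleHolonomy U ![i, j] 0 1 R T : Matrix.specialUnitaryGroup (Fin N) ℂ) : Matrix (Fin N) (Fin N) ℂ).trace :=
    (continuous_fundamentalRep (Fin N)).matrix_trace.comp (continuous_config_rectangleHolonomy _ 0 1 R T)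
  have hwc : ∀ p : Site 2 L, Continuous fun U : GaugeConfig 2 L (Matrix.specialUnitaryGroup (Fin N) ℂ) =>
      Real.exp (-(β * ((N : ℝ) - ((plaquetteHolonomy U p 0 1 : Matrix.specialUnitaryGroup (Fin N) ℂ) :
        Matrix (Fin N) (Fin N) ℂ).trace.re))) := fun p =>
    Real.continuous_exp.comp ((continuous_const.mul (continuous_const.sub (Complex.continuous_re.comp
      ((continuous_fundamentalRep (Fin N)).matrix_trace.comp (continuous_config_plaquetteHolonomy p 0 1))))).neg)
  have hΨc : Continuous fun U : GaugeConfig 2 L (Matrix.specialUnitaryGroup (Fin N) ℂ) =>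
      ∏ p ∈ (range R ×ˢ range T).image (fun q : ℕ × ℕ => (![i + q.1, j + q.2] : Site 2 L)),
        Real.exp (-(β * ((N : ℝ) - ((plaquetteHolonomy U p 0 1 : Matrix.specialUnitaryGroup (Fin N) ℂ) :
          Matrix (Fin N) (Fin N) ℂ).trace.re))) := continuous_finsetProd _ fun p _ => hwc p
  have hΨc' : Continuous fun U : GaugeConfig 2 L (Matrix.specialUnitaryGroup (Fin N) ℂ) =>
      ∏ p ∈ (range R ×ˢ range T).image (fun q : ℕ × ℕ => (![i + q.1, j + q.2] : Site 2 L)),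
        (Real.exp (-(β * ((N : ℝ) - ((plaquetteHolonomy U p 0 1 : Matrix.specialUnitaryGroup (Fin N) ℂ) :
          Matrix (Fin N) (Fin N) ℂ).trace.re))) : ℂ) := continuous_finsetProd _ fun p _ => Complex.continuous_ofReal.comp (hwc p)
  -- positivity of the partition function
  have hZpos : 0 < Z := by
    have hDpos : 0 < ∑' q : ℤ, (Matrix.of fun i j : Fin N => besselI (q + (i : ℤ) - (j : ℤ)).natAbs β).det := by
      rw [← integral_haar_specialUnitaryGroup_fin_exp_mul_trace_re N β]
      exact integral_exp_pos ((by fun_prop : Continuous fun u : Matrix.specialUnitaryGroup (Fin N) ℂ =>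
        Real.exp (β * ((u : Matrix.specialUnitaryGroup (Fin N) ℂ) : Matrix (Fin N) (Fin N) ℂ).trace.re)).integrable_of_hasCompactSupport
          (HasCompactSupport.of_compactSpace _))
    rw [hZ]; exact pow_pos (mul_pos (Real.exp_pos _) hDpos) _
  have hZc : (Z : ℂ) ≠ 0 := by exact_mod_cast hZpos.ne'
  -- clear denominators in the two moments
  have e1 := (div_eq_iff hZpos.ne').1 h1
  have e2 := (div_eq_iff hZc).1 h2
  -- pointwise split `(Re F)² Ψ = (|F|²Ψ + Re(F²Ψ))/2` and integrate
  have hI1 : Integrable (fun U => ‖((rectangleHolonomy U ![i, j] 0 1 R T : Matrix.specialUnitaryGroup (Fin N) ℂ) : Matrix (Fin N) (Fin N) ℂ).trace‖ ^ 2 *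
      ∏ p ∈ (range R ×ˢ range T).image (fun q : ℕ × ℕ => (![i + q.1, j + q.2] : Site 2 L)),
        Real.exp (-(β * ((N : ℝ) - ((plaquetteHolonomy U p 0 1 : Matrix.specialUnitaryGroup (Fin N) ℂ) :
          Matrix (Fin N) (Fin N) ℂ).trace.re)))) μ :=
    integrable_gaugeConfig_of_continuous ((hFc.norm.pow 2).mul hΨc)
  have hI2c : Integrable (fun U => (((rectangleHolonomy U ![i, j] 0 1 R T : Matrix.specialUnitaryGroup (Fin N) ℂ) : Matrix (Fin N) (Fin N) ℂ).trace) ^ 2 *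
      ∏ p ∈ (range R ×ˢ range T).image (fun q : ℕ × ℕ => (![i + q.1, j + q.2] : Site 2 L)),
        (Real.exp (-(β * ((N : ℝ) - ((plaquetteHolonomy U p 0 1 : Matrix.specialUnitaryGroup (Fin N) ℂ) :
          Matrix (Fin N) (Fin N) ℂ).trace.re))) : ℂ)) μ :=
    integrable_gaugeConfig_of_continuous ((hFc.pow 2).mul hΨc')
  have hpt : ∀ U : GaugeConfig 2 L (Matrix.specialUnitaryGroup (Fin N) ℂ), (((rectangleHolonomy U ![i, j] 0 1 R T : Matrix.specialUnitaryGroup (Fin N) ℂ) : Matrix (Fin N) (Fin N) ℂ).trace).re ^ 2 *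
      ∏ p ∈ (range R ×ˢ range T).image (fun q : ℕ × ℕ => (![i + q.1, j + q.2] : Site 2 L)),
        Real.exp (-(β * ((N : ℝ) - ((plaquetteHolonomy U p 0 1 : Matrix.specialUnitaryGroup (Fin N) ℂ) :
          Matrix (Fin N) (Fin N) ℂ).trace.re))) =
      (‖((rectangleHolonomy U ![i, j] 0 1 R T : Matrix.specialUnitaryGroup (Fin N) ℂ) : Matrix (Fin N) (Fin N) ℂ).trace‖ ^ 2 * ∏ p ∈ (range R ×ˢ range T).image (fun q : ℕ × ℕ => (![i + q.1, j + q.2] : Site 2 L)),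
        Real.exp (-(β * ((N : ℝ) - ((plaquetteHolonomy U p 0 1 : Matrix.specialUnitaryGroup (Fin N) ℂ) :
          Matrix (Fin N) (Fin N) ℂ).trace.re))) +
      ((((rectangleHolonomy U ![i, j] 0 1 R T : Matrix.specialUnitaryGroup (Fin N) ℂ) : Matrix (Fin N) (Fin N) ℂ).trace) ^ 2 * ∏ p ∈ (range R ×ˢ range T).image (fun q : ℕ × ℕ => (![i + q.1, j + q.2] : Site 2 L)),
        (Real.exp (-(β * ((N : ℝ) - ((plaquetteHolonomy U p 0 1 : Matrix.specialUnitaryGroup (Fin N) ℂ) :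
          Matrix (Fin N) (Fin N) ℂ).trace.re))) : ℂ)).re) / 2 := by
    intro U
    have hre2 : ∀ z : ℂ, z.re ^ 2 = (‖z‖ ^ 2 + (z ^ 2).re) / 2 := fun z => by
      rw [Complex.sq_norm, Complex.normSq_apply]; simp only [pow_two, Complex.mul_re]; ring
    rw [← Complex.ofReal_prod, Complex.re_mul_ofReal, hre2]
    ring
  have hI2 : Integrable (fun U => ((((rectangleHolonomy U ![i, j] 0 1 R T : Matrix.specialUnitaryGroup (Fin N) ℂ) : Matrix (Fin N) (Fin N) ℂ).trace) ^ 2 *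
      ∏ p ∈ (range R ×ˢ range T).image (fun q : ℕ × ℕ => (![i + q.1, j + q.2] : Site 2 L)),
        (Real.exp (-(β * ((N : ℝ) - ((plaquetteHolonomy U p 0 1 : Matrix.specialUnitaryGroup (Fin N) ℂ) :
          Matrix (Fin N) (Fin N) ℂ).trace.re))) : ℂ)).re) μ :=
    integrable_gaugeConfig_of_continuous (Complex.continuous_re.comp ((hFc.pow 2).mul hΨc'))
  have hre := integral_re hI2c
  simp only [RCLike.re_to_complex] at hre
  simp_rw [hpt]
  rw [integral_div, integral_add hI1 hI2, hre, e1, e2, Complex.re_mul_ofReal]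
  field_simp

/-- **THE EXACT VARIANCE OF THE MEASURED WILSON LOOP IN TWO DIMENSIONS** (`SU(N)`, `N ≥ 2`, every real `β`): for
theory-2's observable `W = N⁻¹ Re tr W_{R×T}` on the free-boundary `R × T` lattice,
`⟨W²⟩_β − ⟨W⟩_β² = (1 + (N²−1)·P_adj^{RT} + Re(d_S·P_S^{RT} + d_A·P_A^{RT}))/(2N²) − P_N^{2RT}`,
the mean `⟨W⟩_β = P_N^{RT}` being GEN-18's exact area law. -/
theorem specialUnitary_open_wilsonLoop_variance_eq (hN : 2 ≤ N) (β : ℝ) (i j : ZMod L) {R T : ℕ}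
    (hR : R + 1 ≤ L) (hT : T + 1 ≤ L) :
    haveI : NeZero N := ⟨by omega⟩
    (∫ U, wilsonLoop (fundamentalRep (Fin N)) ![i, j] 0 1 R T U ^ 2 *
          ∏ p ∈ (range R ×ˢ range T).image (fun q : ℕ × ℕ => (![i + q.1, j + q.2] : Site 2 L)),
            Real.exp (-(β * ((N : ℝ) - ((plaquetteHolonomy U p 0 1 : Matrix.specialUnitaryGroup (Fin N) ℂ) :
              Matrix (Fin N) (Fin N) ℂ).trace.re)))
          ∂(Measure.pi fun _ : Edge 2 L => haarProbability (Matrix.specialUnitaryGroup (Fin N) ℂ))) /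
        (∫ U, ∏ p ∈ (range R ×ˢ range T).image (fun q : ℕ × ℕ => (![i + q.1, j + q.2] : Site 2 L)),
            Real.exp (-(β * ((N : ℝ) - ((plaquetteHolonomy U p 0 1 : Matrix.specialUnitaryGroup (Fin N) ℂ) :
              Matrix (Fin N) (Fin N) ℂ).trace.re)))
          ∂(Measure.pi fun _ : Edge 2 L => haarProbability (Matrix.specialUnitaryGroup (Fin N) ℂ))) -
      ((∫ U, wilsonLoop (fundamentalRep (Fin N)) ![i, j] 0 1 R T U *
          ∏ p ∈ (range R ×ˢ range T).image (fun q : ℕ × ℕ => (![i + q.1, j + q.2] : Site 2 L)),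
            Real.exp (-(β * ((N : ℝ) - ((plaquetteHolonomy U p 0 1 : Matrix.specialUnitaryGroup (Fin N) ℂ) :
              Matrix (Fin N) (Fin N) ℂ).trace.re)))
          ∂(Measure.pi fun _ : Edge 2 L => haarProbability (Matrix.specialUnitaryGroup (Fin N) ℂ))) /
        (∫ U, ∏ p ∈ (range R ×ˢ range T).image (fun q : ℕ × ℕ => (![i + q.1, j + q.2] : Site 2 L)),
            Real.exp (-(β * ((N : ℝ) - ((plaquetteHolonomy U p 0 1 : Matrix.specialUnitaryGroup (Fin N) ℂ) :
              Matrix (Fin N) (Fin N) ℂ).trace.re)))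
          ∂(Measure.pi fun _ : Edge 2 L => haarProbability (Matrix.specialUnitaryGroup (Fin N) ℂ)))) ^ 2 =
      ((1 + ((N : ℝ) ^ 2 - 1) *
          (((∫ u, (‖((u : Matrix.specialUnitaryGroup (Fin N) ℂ) : Matrix (Fin N) (Fin N) ℂ).trace‖ ^ 2 : ℝ) *
              Real.exp (β * ((u : Matrix.specialUnitaryGroup (Fin N) ℂ) : Matrix (Fin N) (Fin N) ℂ).trace.re)
              ∂(haarProbability (Matrix.specialUnitaryGroup (Fin N) ℂ))) /
              (∑' q : ℤ, (Matrix.of fun i j : Fin N => besselI (q + (i : ℤ) - (j : ℤ)).natAbs β).det) - 1) / ((N : ℝ) ^ 2 - 1)) ^ (R * T)) +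
        (((N : ℂ) * (N + 1) / 2) *
            (((∫ u, ((u : Matrix.specialUnitaryGroup (Fin N) ℂ) : Matrix (Fin N) (Fin N) ℂ).trace ^ 2 *
                (Real.exp (β * ((u : Matrix.specialUnitaryGroup (Fin N) ℂ) : Matrix (Fin N) (Fin N) ℂ).trace.re) : ℂ)
                ∂(haarProbability (Matrix.specialUnitaryGroup (Fin N) ℂ))) +
              (∫ u, (((u : Matrix.specialUnitaryGroup (Fin N) ℂ) : Matrix (Fin N) (Fin N) ℂ) *
                ((u : Matrix.specialUnitaryGroup (Fin N) ℂ) : Matrix (Fin N) (Fin N) ℂ)).trace *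
                (Real.exp (β * ((u : Matrix.specialUnitaryGroup (Fin N) ℂ) : Matrix (Fin N) (Fin N) ℂ).trace.re) : ℂ)
                ∂(haarProbability (Matrix.specialUnitaryGroup (Fin N) ℂ)))) /
              (N * (N + 1) * ((∑' q : ℤ, (Matrix.of fun i j : Fin N => besselI (q + (i : ℤ) - (j : ℤ)).natAbs β).det : ℝ) : ℂ))) ^ (R * T) +
          ((N : ℂ) * (N - 1) / 2) *
            (((∫ u, ((u : Matrix.specialUnitaryGroup (Fin N) ℂ) : Matrix (Fin N) (Fin N) ℂ).trace ^ 2 *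
                (Real.exp (β * ((u : Matrix.specialUnitaryGroup (Fin N) ℂ) : Matrix (Fin N) (Fin N) ℂ).trace.re) : ℂ)
                ∂(haarProbability (Matrix.specialUnitaryGroup (Fin N) ℂ))) -
              (∫ u, (((u : Matrix.specialUnitaryGroup (Fin N) ℂ) : Matrix (Fin N) (Fin N) ℂ) *
                ((u : Matrix.specialUnitaryGroup (Fin N) ℂ) : Matrix (Fin N) (Fin N) ℂ)).trace *
                (Real.exp (β * ((u : Matrix.specialUnitaryGroup (Fin N) ℂ) : Matrix (Fin N) (Fin N) ℂ).trace.re) : ℂ)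
                ∂(haarProbability (Matrix.specialUnitaryGroup (Fin N) ℂ)))) /
              (N * (N - 1) * ((∑' q : ℤ, (Matrix.of fun i j : Fin N => besselI (q + (i : ℤ) - (j : ℤ)).natAbs β).det : ℝ) : ℂ))) ^ (R * T)).re) /
        (2 * (N : ℝ) ^ 2) -
      ((∫ u, ((u : Matrix.specialUnitaryGroup (Fin N) ℂ) : Matrix (Fin N) (Fin N) ℂ).trace.re / N *
            Real.exp (-(β * ((N : ℝ) - ((u : Matrix.specialUnitaryGroup (Fin N) ℂ) : Matrix (Fin N) (Fin N) ℂ).trace.re)))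
          ∂(haarProbability (Matrix.specialUnitaryGroup (Fin N) ℂ))) /
        (∫ u, Real.exp (-(β * ((N : ℝ) - ((u : Matrix.specialUnitaryGroup (Fin N) ℂ) : Matrix (Fin N) (Fin N) ℂ).trace.re)))
          ∂(haarProbability (Matrix.specialUnitaryGroup (Fin N) ℂ)))) ^ (2 * (R * T)) := by
  haveI : NeZero N := ⟨by omega⟩
  rw [specialUnitary_openWilsonLoop_eq_plaquette_pow N β i j hR hT, ← pow_mul, mul_comm (R * T) 2]
  congr 1
  -- `wilsonLoop² = N⁻² (Re tr W)²`
  have hsq : ∀ U : GaugeConfig 2 L (Matrix.specialUnitaryGroup (Fin N) ℂ),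
      wilsonLoop (fundamentalRep (Fin N)) ![i, j] 0 1 R T U ^ 2 *
          ∏ p ∈ (range R ×ˢ range T).image (fun q : ℕ × ℕ => (![i + q.1, j + q.2] : Site 2 L)),
            Real.exp (-(β * ((N : ℝ) - ((plaquetteHolonomy U p 0 1 : Matrix.specialUnitaryGroup (Fin N) ℂ) :
              Matrix (Fin N) (Fin N) ℂ).trace.re)))
        = ((N : ℝ) ^ 2)⁻¹ * (((rectangleHolonomy U ![i, j] 0 1 R T : Matrix.specialUnitaryGroup (Fin N) ℂ) :
          Matrix (Fin N) (Fin N) ℂ).trace.re ^ 2 *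
          ∏ p ∈ (range R ×ˢ range T).image (fun q : ℕ × ℕ => (![i + q.1, j + q.2] : Site 2 L)),
            Real.exp (-(β * ((N : ℝ) - ((plaquetteHolonomy U p 0 1 : Matrix.specialUnitaryGroup (Fin N) ℂ) :
              Matrix (Fin N) (Fin N) ℂ).trace.re)))) := by
    intro U
    rw [wilsonLoop, fundamentalRep_apply]
    ring
  simp_rw [hsq]
  rw [integral_const_mul, mul_div_assoc, specialUnitary_open_re_trace_sq_wilsonLoop_eq (L := L) hN β i j hR hT]
  have hN0 : (N : ℝ) ≠ 0 := by exact_mod_cast NeZero.ne N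
  field_simp

end SUVariance

end Summit.Ventures.LatticeQCDFlow.Scoring
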